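import Mathlib
import HarnessLib
import Literature.Analysis.FluidPDE.ClassicalSolution
import Literature.Analysis.FluidPDE.TypeIAncientMild

/-!
# Route `QuarterLogPincer` — objects posited by LINE `thin_cascade` of crux `TypeIQuantSubcubicExp`
  (item stmt-NavierStokesRegularity-24077): the Tao frame, cheap cascades, thin objects

Definitions ONLY — the route-posited objects of the registered skeleton
`Cruxes/TypeIQuantSubcubicExp/Lines/thin_cascade.lean` (ns-idea-7 g0, version of record v4
`972f24fcf0c3`, critic idea-crit-7 PASS-WITH-PRICE), copied VERBATIM and only re-homed into an
importable module (crux workfiles under `Cruxes/` are not importable from `Theorems/`; the line's local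
notation `E3` is spelled out as `EuclideanSpace ℝ (Fin 3)`, nothing else changes), so that the
registered stubs `stub_cheapCascades`, `stub_thinObjectExtraction`, `stub_thinCascadeLiouville` can be
proved BY NAME with their registered signatures in separate Theorems files (lead prover ns-tc-p1).
Same namespace as the line (`…Cruxes.TypeIQuantSubcubicExp.ThinCascade`), same names, same bodies:

* `TaoFrame T u p` — the smooth-solution frame of the crux (classical solution on `[0,T]`, `ν = 1`,
  zero force, every `H^k` seminorm bounded on `[0,T]`);
* `CheapCascade M q K` — a Tao-frame solution with the virtual Type-I bound, backward life
  `T ≥ e^{2K}ρ²`, virtual remaining time `τ ≤ M²e^{−2K}ρ²`, centre value `ρ‖u(T,x₀)‖ ≥ e^K` and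
  final-time annular costs `∫_{ρ<|x−x₀|<e^jρ} ‖u(T)‖³ ≤ q j`, `1 ≤ j ≤ K`;
* `SingularAt v a` — `v` unbounded on every backward parabolic neighbourhood of `(a, 0)`;
* `ThinObject M q v g` — a thin singular Type-I ancient object over the tree's canonical class
  `Literature.Analysis.FluidPDE.IsTypeIAncientMild` with uniform local energy, singular at the
  origin, with a final-time weak trace `g` of logarithmic annular cube budget;
* `UniformScaledEnergy` (appended with skeleton v5, 2026-08-28) — the 4th registered stub's
  statement: the global sup-rate Type-I bound alone bounds Seregin's scaled quantities `A`, `E`,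
  `D` at the final vertex by a constant depending on `M` only.

HONEST FRAMING: nothing is asserted here; the crux `TypeIQuantSubcubicExp`, its parent
`SuperlogCubeRate` and every Navier–Stokes statement remain unproved. No summit statement is proved.
-/

noncomputable section

-- the summit-side namespace `Summit.NavierStokesRegularity.NavierStokesRegularity.…` (single-conjunct summit,
-- D-0017) repeats a component by design; the dupNamespace linter would flag every declaration.
set_option linter.dupNamespace false

namespace Summit.NavierStokesRegularity.NavierStokesRegularity.Cruxes.TypeIQuantSubcubicExp.ThinCascade

open MeasureTheory

/-- The smooth-solution frame of the crux (Tao class on `[0,T]`, `ν = 1`, zero force):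
classical solution with every `H^k` seminorm bounded on `[0,T]`. [this file; verbatim from
`Cruxes/TypeIQuantSubcubicExp/Lines/thin_cascade.lean`] -/
def TaoFrame (T : ℝ) (u : ℝ → EuclideanSpace ℝ (Fin 3) → EuclideanSpace ℝ (Fin 3))
    (p : ℝ → EuclideanSpace ℝ (Fin 3) → ℝ) : Prop :=
  Literature.Analysis.FluidPDE.IsClassicalNSSolutionOn (Set.Icc 0 T) 1 0 u p ∧
    ∀ n : ℕ, ∃ C : NNReal, ∀ t ∈ Set.Icc 0 T,
      eLpNorm (iteratedFDeriv ℝ n (u t)) 2 volume ≤ C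

/-- A CHEAP CASCADE of length `K` with Type-I constant `M` and per-octave budget `q` (centre
`x₀`, observation time `T` = the final time of the frame, window base scale `ρ`): a Tao-frame
solution on `[0,T]` with the virtual Type-I bound `‖u(t,x)‖ ≤ M (T+τ−t)^{-1/2}`, backward life
`T ≥ e^{2K} ρ²`, virtual remaining time `τ ≤ M² e^{−2K} ρ²`, centre value
`ρ ‖u(T,x₀)‖ ≥ e^{K}` (K octaves of concentration below `ρ`), and final-time annular costs
`∫_{ρ<|x−x₀|<e^{j}ρ} ‖u(T)‖³ ≤ q j` for `1 ≤ j ≤ K` (K octaves above `ρ` at average cost `q`).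
No translation normalisation is imposed (the centre is a datum), so that producing a cheap
cascade from a violator needs only restriction in time. [this file; verbatim from the line] -/
def CheapCascade (M q : ℝ) (K : ℕ) : Prop :=
  ∃ (T τ ρ : ℝ) (x₀ : EuclideanSpace ℝ (Fin 3))
    (u : ℝ → EuclideanSpace ℝ (Fin 3) → EuclideanSpace ℝ (Fin 3)) (p : ℝ → EuclideanSpace ℝ (Fin 3) → ℝ),
    TaoFrame T u p ∧ 0 < τ ∧ 0 < ρ ∧
    Real.exp (2 * K) * ρ ^ 2 ≤ T ∧
    τ ≤ M ^ 2 * Real.exp (-2 * (K : ℝ)) * ρ ^ 2 ∧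
    (∀ t ∈ Set.Icc 0 T, ∀ x : EuclideanSpace ℝ (Fin 3),
      ‖u t x‖ ≤ M * (T + τ - t) ^ (-(1 / 2 : ℝ))) ∧
    Real.exp K ≤ ρ * ‖u T x₀‖ ∧
    ∀ j : ℕ, 1 ≤ j → j ≤ K →
      ∫⁻ x in {x : EuclideanSpace ℝ (Fin 3) | ρ < ‖x - x₀‖ ∧ ‖x - x₀‖ < Real.exp j * ρ},
          ENNReal.ofReal (‖u T x‖ ^ 3)
        ≤ ENNReal.ofReal (q * j)

/-- `v` is SINGULAR at the space–time point `(a, 0)`: unbounded on every backward parabolic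
neighbourhood `B_r(a) × (−r², 0)`. [this file; verbatim from the line] -/
def SingularAt (v : ℝ → EuclideanSpace ℝ (Fin 3) → EuclideanSpace ℝ (Fin 3))
    (a : EuclideanSpace ℝ (Fin 3)) : Prop :=
  ∀ r : ℝ, 0 < r → ∀ A : ℝ, ∃ t ∈ Set.Ioo (-(r ^ 2)) 0, ∃ y ∈ Metric.ball a r, A < ‖v t y‖

/-- A THIN singular Type-I ancient object with constants `(M, q)`: a Type-I ancient mild solution
`v` in the KNSS/Oseen gauge (`IsTypeIAncientMild M v`, the tree's canonical class: jointly smooth on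
the open past, divergence-free, Oseen-mild between negative times — which excludes the parasitic
`b(t)` solutions — and `‖v(t,x)‖ ≤ M/√(−t)`; smoothness makes the pointwise singularity clause
essential, i.e. robust to null-set modifications), uniformly locally square-integrable up to the
final time (Seregin's scaled energy),
singular at the origin at time `0`, together with a locally integrable final-time weak trace `g`
(`v(t) ⇀ g` as `t → 0⁻` against smooth compactly supported fields) whose cube deposits at most
`q (1 + log R)` on the annuli `1 < |x| < R`. [this file; verbatim from the line] -/
def ThinObject (M q : ℝ) (v : ℝ → EuclideanSpace ℝ (Fin 3) → EuclideanSpace ℝ (Fin 3))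
    (g : EuclideanSpace ℝ (Fin 3) → EuclideanSpace ℝ (Fin 3)) : Prop :=
  Literature.Analysis.FluidPDE.IsTypeIAncientMild M v ∧
    (∃ E : ℝ, ∀ x₀ : EuclideanSpace ℝ (Fin 3), ∀ t ∈ Set.Ioo (-1 : ℝ) 0,
      ∫⁻ y in Metric.ball x₀ 1, ENNReal.ofReal (‖v t y‖ ^ 2) ≤ ENNReal.ofReal E) ∧
    SingularAt v 0 ∧
    LocallyIntegrable g volume ∧
    (∀ φ : EuclideanSpace ℝ (Fin 3) → EuclideanSpace ℝ (Fin 3), ContDiff ℝ (⊤ : ℕ∞) φ →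
      HasCompactSupport φ →
      Filter.Tendsto (fun t => ∫ x, inner ℝ (v t x) (φ x)) (nhdsWithin 0 (Set.Iio 0))
        (nhds (∫ x, inner ℝ (g x) (φ x)))) ∧
    ∀ R : ℝ, 1 ≤ R →
      ∫⁻ x in {x : EuclideanSpace ℝ (Fin 3) | 1 < ‖x‖ ∧ ‖x‖ < R}, ENNReal.ofReal (‖g x‖ ^ 3)
        ≤ ENNReal.ofReal (q * (1 + Real.log R))


/-- (I1) UNIFORM SCALED ENERGY FROM THE RATE ALONE (skeleton v5, 4th registered stub
`stub_uniformScaledEnergy : UniformScaledEnergy`; size L; no wall; GLOBAL frame).  For every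
Type-I constant `M` there is `C = C(M)` such that every Tao-frame solution on `[0,T]` with the
virtual Type-I bound `‖u(t,x)‖ ≤ M (T+τ−t)^{-1/2}` has, at EVERY centre `x` and EVERY scale
`0 < r`, `r² ≤ T`, Seregin's scaled quantities at the final vertex bounded by `C`:
`A`: `sup_{t ∈ [T−r²,T]} r⁻¹ ∫_{B(x,r)} ‖u(t)‖² ≤ C`; `E`: `r⁻¹ ∬_{[T−r²,T]×B(x,r)} ‖∇u‖² ≤ C`;
`D`: `r⁻² ∬_{[T−r²,T]×B(x,r)} |p − [p]_{B(x,r)}(t)|^{3/2} ≤ C` (so `𝐈 ≤ C(M)` in the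
Albritton–Barker local-energy Type-I frame, uniformly over any family of such solutions).  Not a
Literature fact: no printed source states it (Albritton–Barker 2019, Remark 3.2, arXiv:1811.00502
p. 7, call the neighbouring local statement unknown); it is an honest registered obligation of the
line. [this file; verbatim from `Cruxes/TypeIQuantSubcubicExp/Lines/thin_cascade.lean` v5, the
line's local notation `E3` spelled out] -/
def UniformScaledEnergy : Prop :=
  ∀ M : ℝ, ∃ C : ℝ, ∀ (T τ : ℝ) (u : ℝ → EuclideanSpace ℝ (Fin 3) → EuclideanSpace ℝ (Fin 3))
    (p : ℝ → EuclideanSpace ℝ (Fin 3) → ℝ),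
    TaoFrame T u p → 0 < τ →
    (∀ t ∈ Set.Icc 0 T, ∀ x : EuclideanSpace ℝ (Fin 3),
      ‖u t x‖ ≤ M * (T + τ - t) ^ (-(1 / 2 : ℝ))) →
    ∀ (x : EuclideanSpace ℝ (Fin 3)) (r : ℝ), 0 < r → r ^ 2 ≤ T →
      (∀ t ∈ Set.Icc (T - r ^ 2) T,
          ∫⁻ y in Metric.ball x r, ENNReal.ofReal (‖u t y‖ ^ 2) ≤ ENNReal.ofReal (C * r)) ∧
      (∫⁻ t in Set.Icc (T - r ^ 2) T, ∫⁻ y in Metric.ball x r,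
          ENNReal.ofReal (‖fderiv ℝ (u t) y‖ ^ 2) ≤ ENNReal.ofReal (C * r)) ∧
      (∫⁻ t in Set.Icc (T - r ^ 2) T, ∫⁻ y in Metric.ball x r,
          ENNReal.ofReal (|p t y - ⨍ z in Metric.ball x r, p t z| ^ (3 / 2 : ℝ))
            ≤ ENNReal.ofReal (C * r ^ 2))

end Summit.NavierStokesRegularity.NavierStokesRegularity.Cruxes.TypeIQuantSubcubicExp.ThinCascade

end
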